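import Summits.Ventures.HodgeRepro2.T5SU11SphericalTwo

/-!
# The Poisson-integral form of the spherical functions: `φ_λ(g) = ∫_K P(u² g·0)^{λ/2} dk`

Since `e^{2 t(g)} = P(g·0)` (`T5SU11IwasawaProjection.exp_two_mul_iwasawaT`) and `(rot u · g)·0 = u² (g·0)`
(`T5SU11CoeffSqCartan.orbit_rot_mul`), the spherical function `sph λ g = ∫_K e^{λ t(k g)} dk` of
`T5SU11SphericalFunction` is the **Poisson integral `∫_K P(u² · g·0)^{λ/2} dk`** over the circle
through the orbit point (`sph_eq_integral_poisson`; `exp_iwasawaT_rot_mul`: `e^{λ t(rot u · g)} = P(u² g·0)^{λ/2}`),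
a function of `g·0` alone (`sph_eq_of_orbit_eq`); in particular `φ_2(g) = ∫_K P(u² g·0) dk = 1`
recovers `T5SU11SphericalTwo.sph_two`, and the Poisson kernel itself is `P(z) = e^{2 t(s(z))}` for the
section `s(z)` (`poisson_eq_exp_iwasawaT_sec`). Nothing is claimed about (N).

Blind lane: Mathlib + the HodgeRepro2 prefix only; no sorry; axioms ⊆ {propext, Classical.choice,
Quot.sound}.
-/

namespace Summit.Ventures.HodgeRepro2.T5SU11SphericalPoisson

open MeasureTheory Metric Set Complex
open T5PoincareDensity T5SU11Unimodular T5SU11Fibration T5SU11Cartan T5SU11OneParameter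
  T5BergmanCoefficient T5SU11IwasawaProjection T5SU11CartanProjection T5HaarCircle
  T5SU11SphericalFunction T5SU11Horocycle T5SU11HorocycleTransitive T5SU11CoeffSqCartan
  T5SU11SphericalTwo
open scoped Real

/-- `P(g·0) > 0`. -/
lemma poisson_orbit_pos (g : SU11) : 0 < poisson (orbit g) := poisson_pos (orbit_mem_ball g)

/-- **`e^{λ t(rot u · g)} = P(u² g·0)^{λ/2}`**: the Iwasawa exponential of `k g` is a power of the Poisson
kernel at the rotated orbit point. -/
theorem exp_iwasawaT_rot_mul (lam : ℝ) (u : Circle) (g : SU11) :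
    Real.exp (lam * iwasawaT (rot u * g)) = poisson ((u : ℂ) ^ 2 * orbit g) ^ (lam / 2) := by
  have h := exp_two_mul_iwasawaT (rot u * g)
  rw [orbit_rot_mul] at h
  rw [← h, ← Real.exp_mul]
  congr 1
  ring

/-- **The Poisson-integral form of the spherical function**:
`sph λ g = ∫_K P(u² · g·0)^{λ/2} dk`. -/
theorem sph_eq_integral_poisson [MeasurableSpace Circle] [BorelSpace Circle] (lam : ℝ) (g : SU11) :
    sph lam g = ∫ u, poisson ((u : ℂ) ^ 2 * orbit g) ^ (lam / 2) ∂haarCircle := by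
  unfold sph
  simp_rw [exp_iwasawaT_rot_mul]

/-- **The spherical function is a function of the orbit point**: `g·0 = h·0 → sph λ g = sph λ h`. -/
theorem sph_eq_of_orbit_eq [MeasurableSpace Circle] [BorelSpace Circle] (lam : ℝ) {g h : SU11}
    (hgh : orbit g = orbit h) : sph lam g = sph lam h := by
  rw [sph_eq_integral_poisson, sph_eq_integral_poisson, hgh]

/-- **`∫_K P(u² z) dk = 1` for every `z ∈ 𝔻`** (the Poisson integral of the constant `1`), from
`φ_2 ≡ 1`. -/
theorem integral_poisson_sq_mul [MeasurableSpace Circle] [BorelSpace Circle] {z : ℂ}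
    (hz : z ∈ ball (0 : ℂ) 1) : ∫ u, poisson ((u : ℂ) ^ 2 * z) ∂haarCircle = 1 := by
  have h := sph_two (sec z)
  rw [sph_eq_integral_poisson, orbit_sec hz] at h
  simp only [div_self (two_ne_zero' ℝ), Real.rpow_one] at h
  exact h

/-- **`P(z) = e^{2 t(s(z))}`**: the Poisson kernel is the Iwasawa exponential of the section. -/
theorem poisson_eq_exp_iwasawaT_sec {z : ℂ} (hz : z ∈ ball (0 : ℂ) 1) :
    poisson z = Real.exp (2 * iwasawaT (sec z)) := by
  rw [exp_two_mul_iwasawaT, orbit_sec hz]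

/-- `t(s(z)) = (log P(z)) / 2`. -/
theorem iwasawaT_sec {z : ℂ} (hz : z ∈ ball (0 : ℂ) 1) :
    iwasawaT (sec z) = Real.log (poisson z) / 2 := by
  rw [poisson_eq_exp_iwasawaT_sec hz, Real.log_exp]
  ring

end Summit.Ventures.HodgeRepro2.T5SU11SphericalPoisson
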